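import Summits.FinalStateConjecture.FinalStateConjecture.Theorems.PhaseMixingCaptureWeakCosmicCensorshipMGHDStubScriTransfer
import Summits.FinalStateConjecture.FinalStateConjecture.Statement
import Literature.Geometry.Lorentzian.StabilityCauchy
import Literature.Geometry.Lorentzian.CauchyDevelopmentGlobalHyperbolicityProofs
import Literature.Geometry.Lorentzian.CausalFutureCompactSet
import Literature.Geometry.Lorentzian.CauchyHypersurfaceCausalProofs
import Literature.Geometry.Lorentzian.CauchyHypersurfaceGlobalHyperbolicity
import Literature.Geometry.Lorentzian.CausalityClosedProofs
import Literature.Geometry.Lorentzian.FutureNullCompleteness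
import Literature.Geometry.Lorentzian.NullInfinityConstSmul
import Literature.Geometry.Lorentzian.GeodesicMaximalFlow
import Literature.Geometry.Lorentzian.ConvergenceTransport
import Literature.Geometry.Lorentzian.CausalCurveNullGeodesic
import HarnessLib

/-!
# Crux `PhaseMixingCapture.CaptureSufficesC2` (stmt-FinalStateConjecture-14986), line `Sketch`,
# stub `stub_softShieldedScri` — support file 2a: causal bookkeeping and ray lifting for the LEAF TRANSFER

**Far-origin sojourn completeness of a realised leaf development ascends to the ambient Cauchy
development.**  This is the generic (Kerr-free) third step (c) of `stub_softShieldedScri`,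
generalising the landed `stub_scriTransfer` (crux 9952) from "an embedding over a SUB-DATUM
`Φ : N → X`" to "an embedding over a LEAF `j = χ ∘ ι_S : N → 𝓜` lying in the causal past of the
data hypersurface `ι X`, with the ray origins on `ι X` joined to the leaf by PRE-SEGMENTS of the
rays themselves".

Setting.  `𝓜` is a Cauchy development of the datum `D` on `X`; `𝒮` is ANY data embedding of a
datum `D'` on `N` (the leaf datum; in the stub: the MGHD `𝒟_S` of the leaf datum `D_S` on
`Kerr.slice a M`), realised in `𝓜` by a smooth, isometric, time-orientation preserving map
`χ : 𝒮 → 𝓜` (the output of `HypersurfaceMGHDRealised`); the leaf `χ(ι_S N)` lies in `J⁻(ι X)`;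
`𝒮` has complete future null infinity in Christodoulou's sojourn form as seen from the origins
`A ⊆ N` (`DataEmbedding.HasCompleteFutureNullInfinityFrom`, the conclusion
`HasCompleteFutureNullInfinityFar` of `CaptureAtC2` being the case `A = far slice`); and the
FOOT-POINT HYPOTHESIS holds: there is `c > 0` such that for every compact `C ⊆ N` there is a
compact `K ⊆ X` such that every normalised null ray `γ : dom` of `𝓜` from a point `ι x`, `x ∉ K`,
passes at some parameter `−t₀ ≤ 0` through a leaf point `χ(ι_S p)` with `p ∈ A ∖ C`, with
`g(γ'(−t₀), dχ ν_S(p)) ≥ −c` (bounded renormalisation factor), its pre-segment `γ[−t₀, 0)`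
avoiding `J⁺(χ(ι_S C))` (in the stub this is the Kerr optics of the exact sandwich between the bent
slice and the flat leaf: the affine factor is `1 + O(M/r)` and the pre-segment stays at radius
`≳ r − O(log r)`).  Conclusion: `Summit.FinalStateConjecture.HasCompleteNullInfinity 𝓜`.

Contents (all proved, no `sorry`, no new definitions):

* `CauchyDevelopment.isCompact_causalFuture_inter_causalPast_range_of_isCompact` —
  `J⁺(K) ∩ J⁻(ι X)` is compact for compact `K` (Hawking–Ellis 1973, Prop. 6.6.6 for sets, from the
  tree's singleton version by the covering `K ⊆ ⋃ I⁺(kᵢ⁻)`);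
* `CauchyDevelopment.isCompact_preimage_embed_causalFuture` — `ι⁻¹(J⁺(K))` is compact;
* `CauchyDevelopment.exists_embed_between` — a causal curve from a point of `J⁻(ι X)` to a point of
  `J⁺(ι X)` passes through `ι X` (connectedness: `𝓜 ∖ ι X = I⁺ ⊔ I⁻`);
* `exists_isNormalisedNullRayFrom_leaf_lift` — normalised null rays of `𝓜` from a leaf point,
  normalised against the pushed-forward leaf normal, lift to normalised null rays of `𝒮`
  (maximal geodesics lift along local isometries, the landed `exists_isMaximalGeodesicOn_lift`);
* `isMaximalGeodesicOn_comp_affine` — affine reparametrisations of maximal geodesics are maximal;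
* `stub_softShieldedScri_embedPreimageCompact` — the registered sub-goal form of
  `isCompact_preimage_embed_causalFuture`.

The leaf transfer itself (`hasCompleteNullInfinity_of_leaf`) is the sequel file
`…StubSoftShieldedScriLeafTransfer.lean`.

References: D. Christodoulou, CQG 16 (1999) A23, pp. A26–A27; M. Dafermos, I. Rodnianski,
arXiv:0811.0354, §2.6.2; B. O'Neill, *Semi-Riemannian geometry* (1983), Ch. 3, Prop. 3.24 and
Lemma 3.21, Ch. 5, p. 145, Ch. 14, Lemma 14.22, Lemma 14.29, pp. 402–403; S. W. Hawking,
G. F. R. Ellis (1973), §6.5–§6.6, Prop. 6.6.6.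
-/

set_option linter.dupNamespace false

noncomputable section

open scoped Manifold ContDiff Topology
open Set Function Filter Topology MeasureTheory Literature.Geometry.Lorentzian
open Summit.FinalStateConjecture.FinalStateConjecture.Theorems.PhaseMixingCapture.WeakCosmicCensorshipMGHD
  (exists_isMaximalGeodesicOn_lift)

namespace Summit.FinalStateConjecture.FinalStateConjecture.Theorems.CaptureSufficesC2.Sketch

namespace SoftShieldedScri

universe u v

/-! ## Causal bookkeeping in a Cauchy development -/

section Causal

variable {X : Type u} [TopologicalSpace X] [ChartedSpace E3 X] [IsManifold (𝓡 3) ∞ X]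
  [ConnectedSpace X] {D : InitialDataSet (𝓡 3) X}

/-- The Levi-Civita connection of the (smooth) metric of a Cauchy development is `C¹` (the tree's
`isLocallyContMDiff_leviCivita_holds`); local instance for the geodesic lemmas. [folklore] -/
theorem contMDiffCovariantDerivative_leviCivita (𝓜 : CauchyDevelopment D)
    [𝓜.metric.HasLeviCivita] :
    CovariantDerivative.ContMDiffCovariantDerivative 𝓜.metric.leviCivita 1 :=
  ⟨𝓜.metric.toPseudoRiemannianMetric.isLocallyContMDiff_leviCivita_holds 1
    (by rw [show ((1 : ℕ∞) : ℕ∞ω) + 1 = 2 by norm_num]; exact WithTop.coe_le_coe.2 le_top)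
    univ isOpen_univ⟩

/-- **`J⁺(K) ∩ J⁻(ι X)` is compact for compact `K` in a Cauchy development** (Hawking–Ellis 1973,
Prop. 6.6.6, set form).  Cover `K` by finitely many chronological futures `I⁺(kᵢ⁻)` of points
slightly to the past (`exists_mem_nhds_mem_chronologicalFuture`); then
`J⁺(K) ∩ J⁻(ι X) ⊆ ⋃ᵢ J⁺(kᵢ⁻) ∩ J⁻(ι X)` (push-up `J⁺ ∘ J⁺ = J⁺`), a finite union of compact sets
(the tree's singleton version `isCompact_causalFuture_inter_causalPast_range`), and the left side
is closed (`J⁺(K)` is closed for compact `K` in a globally hyperbolic spacetime, `J⁻(ι X)` is the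
complement of the open `I⁺(ι X)`). [cite: HawkingEllis1973CUP, §6.6, Prop. 6.6.6 (p. 211)] -/
theorem _root_.Literature.Geometry.Lorentzian.CauchyDevelopment.isCompact_causalFuture_inter_causalPast_range_of_isCompact
    (𝓜 : CauchyDevelopment D) {K : Set 𝓜.carrier} (hK : IsCompact K) :
    IsCompact (𝓜.metric.causalFuture 𝓜.timeOrientation K ∩
      𝓜.metric.causalPast 𝓜.timeOrientation (range 𝓜.embed)) := by
  classical
  have hn1 : (1 : ℕ∞ω) ≤ ∞ := WithTop.coe_le_coe.mpr le_top
  have hn2 : (2 : ℕ∞ω) ≤ ∞ := WithTop.coe_le_coe.mpr le_top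
  -- points slightly to the past of each point of `K`
  have hchoice : ∀ k ∈ K, ∃ k' : 𝓜.carrier,
      k ∈ 𝓜.metric.chronologicalFuture 𝓜.timeOrientation {k'} := fun k _ ↦ by
    obtain ⟨k', -, hk'⟩ := LorentzianMetric.exists_mem_nhds_mem_chronologicalFuture
      (g := 𝓜.metric) (τ := 𝓜.timeOrientation) hn1 (Filter.univ_mem : (univ : Set _) ∈ 𝓝 k)
    exact ⟨k', hk'⟩
  choose! kp hkp using hchoice
  obtain ⟨t, ht⟩ := hK.elim_finite_subcover
    (fun k : K ↦ 𝓜.metric.chronologicalFuture 𝓜.timeOrientation {kp k})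
    (fun k ↦ LorentzianMetric.isOpen_chronologicalFuture_of_boundaryless _ _ _)
    (fun k hk ↦ mem_iUnion.2 ⟨⟨k, hk⟩, hkp k hk⟩)
  set B : Set 𝓜.carrier := ⋃ k ∈ t, (𝓜.metric.causalFuture 𝓜.timeOrientation {kp (k : 𝓜.carrier)} ∩
    𝓜.metric.causalPast 𝓜.timeOrientation (range 𝓜.embed)) with hB
  have hBc : IsCompact B :=
    t.isCompact_biUnion fun k _ ↦ 𝓜.isCompact_causalFuture_inter_causalPast_range _
  have hsub : 𝓜.metric.causalFuture 𝓜.timeOrientation K ∩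
      𝓜.metric.causalPast 𝓜.timeOrientation (range 𝓜.embed) ⊆ B := by
    rintro x ⟨hxJ, hxP⟩
    rw [LorentzianMetric.causalFuture_eq_biUnion] at hxJ
    simp only [mem_iUnion, exists_prop] at hxJ
    obtain ⟨k, hkK, hxk⟩ := hxJ
    have hk := ht hkK
    simp only [mem_iUnion, exists_prop] at hk
    obtain ⟨i, hit, hki⟩ := hk
    have hxi : x ∈ 𝓜.metric.causalFuture 𝓜.timeOrientation
        (𝓜.metric.causalFuture 𝓜.timeOrientation {kp (i : 𝓜.carrier)}) :=
      LorentzianMetric.causalFuture_mono (singleton_subset_iff.2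
        (LorentzianMetric.chronologicalFuture_subset_causalFuture _ _ _ hki)) hxk
    rw [LorentzianMetric.causalFuture_causalFuture_eq hn2] at hxi
    rw [hB]
    exact mem_iUnion₂.2 ⟨i, hit, hxi, hxP⟩
  have hJ : IsClosed (𝓜.metric.causalFuture 𝓜.timeOrientation K) :=
    𝓜.isGloballyHyperbolic.isClosed_causalFuture_of_isCompact hn2 hK
  have hP : IsClosed (𝓜.metric.causalPast 𝓜.timeOrientation (range 𝓜.embed)) :=
    𝓜.isCauchyHypersurface.reverse.isClosed_causalFuture_set hn2
  exact hBc.of_isClosed_subset (hJ.inter hP) hsub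

/-- **`ι⁻¹(J⁺(K))` is compact for compact `K` in a Cauchy development**: `ι X ⊆ J⁻(ι X)`, so the
preimage is that of the compact `J⁺(K) ∩ J⁻(ι X)` under the closed embedding `ι` (a smooth
embedding with closed range, Cauchy hypersurfaces being closed, O'Neill 1983, Lemma 14.29).
[cite: ONeillSemiRiemannian1983, Ch. 14, Lemma 14.29 (p. 415)] -/
theorem _root_.Literature.Geometry.Lorentzian.CauchyDevelopment.isCompact_preimage_embed_causalFuture
    (𝓜 : CauchyDevelopment D) {K : Set 𝓜.carrier} (hK : IsCompact K) :
    IsCompact (𝓜.embed ⁻¹' 𝓜.metric.causalFuture 𝓜.timeOrientation K) := by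
  have hn2 : (2 : ℕ∞ω) ≤ ∞ := WithTop.coe_le_coe.mpr le_top
  have hcl : IsClosed (range 𝓜.embed) :=
    LorentzianMetric.IsCauchyHypersurface.isClosed_holds hn2 𝓜.isCauchyHypersurface
  have hce : Topology.IsClosedEmbedding 𝓜.embed := ⟨𝓜.isSmoothEmbedding.isEmbedding, hcl⟩
  have heq : 𝓜.embed ⁻¹' 𝓜.metric.causalFuture 𝓜.timeOrientation K =
      𝓜.embed ⁻¹' (𝓜.metric.causalFuture 𝓜.timeOrientation K ∩
        𝓜.metric.causalPast 𝓜.timeOrientation (range 𝓜.embed)) := by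
    ext x
    simp only [mem_preimage, mem_inter_iff]
    exact ⟨fun h ↦ ⟨h, LorentzianMetric.subset_causalPast _ _ _ (mem_range_self x)⟩,
      fun h ↦ h.1⟩
  rw [heq]
  exact hce.isCompact_preimage (𝓜.isCompact_causalFuture_inter_causalPast_range_of_isCompact hK)

/-- **A causal curve from `J⁻(ι X)` to `J⁺(ι X)` crosses `ι X`.**  If `a ∈ J⁻(ι X)`, `b ∈ J⁺(a)`
and `b ∈ J⁺(ι X)`, then some point `ι x` of the data hypersurface satisfies `a ≤ ι x ≤ b`: the
connecting causal curve has connected image, `𝓜 ∖ ι X = I⁺(ι X) ⊔ I⁻(ι X)` with both pieces open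
(O'Neill 1983, Lemma 14.29), `J⁺(ι X) = 𝓜 ∖ I⁻(ι X)` and `J⁻(ι X) = 𝓜 ∖ I⁺(ι X)`.
[cite: ONeillSemiRiemannian1983, Ch. 14, Lemma 14.29 (p. 415)] -/
theorem _root_.Literature.Geometry.Lorentzian.CauchyDevelopment.exists_embed_between
    (𝓜 : CauchyDevelopment D) {a b : 𝓜.carrier}
    (ha : a ∈ 𝓜.metric.causalPast 𝓜.timeOrientation (range 𝓜.embed))
    (hab : b ∈ 𝓜.metric.causalFuture 𝓜.timeOrientation {a})
    (hb : b ∈ 𝓜.metric.causalFuture 𝓜.timeOrientation (range 𝓜.embed)) :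
    ∃ x : X, 𝓜.embed x ∈ 𝓜.metric.causalFuture 𝓜.timeOrientation {a} ∧
      b ∈ 𝓜.metric.causalFuture 𝓜.timeOrientation {𝓜.embed x} := by
  have hn2 : (2 : ℕ∞ω) ≤ ∞ := WithTop.coe_le_coe.mpr le_top
  have hS := 𝓜.isCauchyHypersurface
  -- `J⁺(ι X) = (I⁻(ι X))ᶜ`, `J⁻(ι X) = (I⁺(ι X))ᶜ`
  have hJF : 𝓜.metric.causalFuture 𝓜.timeOrientation (range 𝓜.embed) =
      (𝓜.metric.chronologicalPast 𝓜.timeOrientation (range 𝓜.embed))ᶜ :=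
    hS.causalFuture_eq_compl_chronologicalPast hn2
  have hJP : 𝓜.metric.causalPast 𝓜.timeOrientation (range 𝓜.embed) =
      (𝓜.metric.chronologicalFuture 𝓜.timeOrientation (range 𝓜.embed))ᶜ := by
    have h := hS.reverse.causalFuture_eq_compl_chronologicalPast hn2
    rw [LorentzianMetric.chronologicalPast_reverse] at h
    exact h
  -- a point of `J⁺(ι X) ∩ J⁻(ι X)` lies on `ι X`
  have honS : ∀ z, z ∈ 𝓜.metric.causalPast 𝓜.timeOrientation (range 𝓜.embed) →
      z ∈ 𝓜.metric.causalFuture 𝓜.timeOrientation (range 𝓜.embed) → z ∈ range 𝓜.embed := by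
    intro z hzP hzF
    by_contra hzS
    rcases hS.mem_chronologicalFuture_union_chronologicalPast hn2 hzS with h | h
    · rw [hJP] at hzP; exact hzP h
    · rw [hJF] at hzF; exact hzF h
  rcases hab with hba | ⟨a', ha', c, t₁, t₂, ht, hc, hca, hcb⟩
  · -- `b = a`
    have hba' : b = a := hba
    subst hba'
    obtain ⟨x, hx⟩ := honS b ha hb
    exact ⟨x, by rw [hx]; exact LorentzianMetric.subset_causalFuture _ _ _ rfl,
      by rw [hx]; exact LorentzianMetric.subset_causalFuture _ _ _ rfl⟩
  · have ha'' : a' = a := ha'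
    subst ha''
    -- the image of the connecting curve is connected and meets `ι X`
    have hcont : ContinuousOn c (Icc t₁ t₂) := fun s hs ↦ (hc.continuousAt hs).continuousWithinAt
    have hmeet : ∃ u ∈ Icc t₁ t₂, c u ∈ range 𝓜.embed := by
      by_contra hno
      push Not at hno
      have hpre : IsPreconnected (c '' Icc t₁ t₂) := isPreconnected_Icc.image c hcont
      have hcover : c '' Icc t₁ t₂ ⊆ 𝓜.metric.chronologicalFuture 𝓜.timeOrientation (range 𝓜.embed) ∪
          𝓜.metric.chronologicalPast 𝓜.timeOrientation (range 𝓜.embed) := by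
        rintro _ ⟨u, hu, rfl⟩
        exact hS.mem_chronologicalFuture_union_chronologicalPast hn2 (hno u hu)
      rcases hpre.subset_or_subset
        (LorentzianMetric.isOpen_chronologicalFuture_of_boundaryless _ _ _)
        (LorentzianMetric.isOpen_chronologicalPast_of_boundaryless _ _ _)
        (hS.disjoint_chronologicalFuture_chronologicalPast hn2) hcover with h | h
      · have : c t₁ ∈ 𝓜.metric.chronologicalFuture 𝓜.timeOrientation (range 𝓜.embed) :=
          h ⟨t₁, left_mem_Icc.2 ht.le, rfl⟩
        rw [hca, hJP] at *
        exact ha this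
      · have : c t₂ ∈ 𝓜.metric.chronologicalPast 𝓜.timeOrientation (range 𝓜.embed) :=
          h ⟨t₂, right_mem_Icc.2 ht.le, rfl⟩
        rw [hcb] at this
        rw [hJF] at hb
        exact hb this
    obtain ⟨u, hu, x, hx⟩ := hmeet
    refine ⟨x, ?_, ?_⟩
    · have h1 := IsFutureCausalCurveOn.apply_mem_causalFuture (τ := 𝓜.timeOrientation) hu.1 (hc.mono (Icc_subset_Icc_right hu.2))
      rw [hca, ← hx] at h1
      exact h1
    · have h2 := IsFutureCausalCurveOn.apply_mem_causalFuture (τ := 𝓜.timeOrientation) hu.2 (hc.mono (Icc_subset_Icc_left hu.1))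
      rw [hcb, ← hx] at h2
      exact h2

end Causal

/-! ## Rays through a leaf: lifting and reparametrisation -/

section Leaf

variable {X : Type u} [TopologicalSpace X] [ChartedSpace E3 X] [IsManifold (𝓡 3) ∞ X]
  [ConnectedSpace X] {D : InitialDataSet (𝓡 3) X}
  {N : Type v} [TopologicalSpace N] [ChartedSpace E3 N] [IsManifold (𝓡 3) ∞ N]
  [ConnectedSpace N] {D' : InitialDataSet (𝓡 3) N}

/-- **Normalised null rays of `𝓜` from a leaf point lift to normalised null rays of the leaf
development.**  Let `𝓜` be a data embedding of `D` (on `X`), `𝒮` a data embedding of `D'` (on `N`)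
and `χ : 𝒮 → 𝓜` smooth, isometric and time-orientation preserving (the leaf is `χ ∘ ι_S`, its
normal the pushed-forward normal `p ↦ dχ (ν_S p)`).  Every normalised null ray `γ : dom` of `𝓜`
from the leaf point `χ (ι_S p)`, normalised against `dχ (ν_S p)`, restricts on some `dom' ⊆ dom` to
`χ ∘ γ'`, `γ' : dom'` a normalised null ray of `𝒮` from `p`: the maximal lift with data
`(ι_S p, dχ⁻¹ γ'(0))` (`exists_isMaximalGeodesicOn_lift`, O'Neill 1983, Ch. 3, Prop. 3.24) has null,
future-directed (`dχ` is a time-orientation preserving linear isometry) and normalised velocity.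
Leaf form of the landed `exists_isNormalisedNullRayFrom_lift` (sub-datum form, crux 9952).
Christodoulou, CQG 16 (1999) A23, p. A26; O'Neill 1983, Ch. 3, pp. 90–91, Ch. 5, p. 145.
[cite: ONeillSemiRiemannian1983, Ch. 3, Prop. 24] -/
theorem exists_isNormalisedNullRayFrom_leaf_lift (𝓜 : DataEmbedding D) (𝒮 : DataEmbedding D')
    {χ : 𝒮.carrier → 𝓜.carrier} (hχ : ContMDiff (𝓡 4) (𝓡 4) ∞ χ)
    (hiso : 𝒮.metric.IsIsometricImmersion 𝓜.metric.toPseudoRiemannianMetric χ)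
    (hτ : 𝒮.timeOrientation.PreservesTimeOrientation χ 𝓜.timeOrientation)
    [𝓜.metric.HasLeviCivita] [𝒮.metric.HasLeviCivita]
    {p : N} {γ : ℝ → 𝓜.carrier} {dom : Set ℝ}
    (hγ : 𝓜.metric.IsNormalisedNullRayFrom 𝓜.timeOrientation (χ ∘ 𝒮.embed)
      (fun q ↦ mfderiv (𝓡 4) (𝓡 4) χ (𝒮.embed q) (𝒮.normal q)) p γ dom) :
    ∃ (γ' : ℝ → 𝒮.carrier) (dom' : Set ℝ),
      𝒮.metric.IsNormalisedNullRayFrom 𝒮.timeOrientation 𝒮.embed 𝒮.normal p γ' dom' ∧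
        dom' ⊆ dom ∧ ∀ t ∈ dom', χ (γ' t) = γ t := by
  -- `dχ` preserves scalar products, hence is injective
  have hval : ∀ (y : 𝒮.carrier) (u u' : TangentSpace (𝓡 4) y), 𝒮.metric.val y u u' =
      𝓜.metric.val (χ y) (mfderiv (𝓡 4) (𝓡 4) χ y u) (mfderiv (𝓡 4) (𝓡 4) χ y u') :=
    fun y u u' ↦ by
      have h := congrArg (fun b ↦ b u u') (hiso.2 y)
      simpa only [pullbackBilin_apply] using h.symm
  have hχ' : ∀ y, Injective (mfderiv (𝓡 4) (𝓡 4) χ y) := fun y ↦ by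
    refine (injective_iff_map_eq_zero _).2 fun u hu ↦ 𝒮.metric.nondegenerate y u fun u' ↦ ?_
    rw [hval, hu, map_zero]
    rfl
  have hdim : Module.finrank ℝ E4 = Module.finrank ℝ E4 := rfl
  have hχ1 : ContMDiff (𝓡 4) (𝓡 4) (∞ + 1) χ := hχ
  -- initial data of the lift
  have hx0 : χ (𝒮.embed p) = γ 0 := hγ.apply_zero.symm
  set w : TangentSpace (𝓡 4) (𝒮.embed p) :=
    (mfderivEquivOfInjective (I := 𝓡 4) (I' := 𝓡 4) χ (𝒮.embed p) (hχ' _) hdim).symm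
      (show TangentSpace (𝓡 4) (χ (𝒮.embed p)) from velocity (𝓡 4) γ 0) with hw_def
  have hLw : mfderiv (𝓡 4) (𝓡 4) χ (𝒮.embed p) w = velocity (𝓡 4) γ 0 :=
    mfderiv_mfderivEquivOfInjective_symm χ _ (hχ' _) hdim _
  obtain ⟨γ', D₁, hmax', h0D', hγ'0, hγ'v, hD', hagree⟩ :=
    exists_isMaximalGeodesicOn_lift (g := 𝓜.metric.toPseudoRiemannianMetric)
      (g' := 𝒮.metric.toPseudoRiemannianMetric) hχ1 hχ' hdim hiso.2 hγ.isMaximalGeodesicOn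
      hγ.zero_mem hx0 hLw
  refine ⟨γ', D₁, ⟨hmax', h0D', hγ'0, ?_, ?_, ?_⟩, hD', hagree⟩
  · -- null
    have key : ∀ (y : 𝒮.carrier) (_ : y = 𝒮.embed p) (u : E4) (_ : u = w),
        𝒮.metric.IsNull (show TangentSpace (𝓡 4) y from u) := by
      rintro y rfl u rfl
      refine ⟨?_, fun hw0 ↦ hγ.isNull_velocity.2 ?_⟩
      · rw [hval, hLw]
        have key' : ∀ (x : 𝓜.carrier) (_ : x = γ 0),
            𝓜.metric.val x (show TangentSpace (𝓡 4) x from velocity (𝓡 4) γ 0)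
              (show TangentSpace (𝓡 4) x from velocity (𝓡 4) γ 0) = 0 := by
          rintro x rfl
          exact hγ.isNull_velocity.1
        exact key' _ hx0
      · rw [← hLw, hw0, map_zero]
        rfl
    exact key _ hγ'0 _ hγ'v
  · -- future-directed
    have key : ∀ (y : 𝒮.carrier) (_ : y = 𝒮.embed p) (u : E4) (_ : u = w),
        𝒮.timeOrientation.IsFutureDirected (show TangentSpace (𝓡 4) y from u) := by
      rintro y rfl u rfl
      refine hτ.isFutureDirected_of_mfderiv hiso.2 ?_
      rw [hLw]
      have key' : ∀ (x : 𝓜.carrier) (_ : x = γ 0),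
          𝓜.timeOrientation.IsFutureDirected
            (show TangentSpace (𝓡 4) x from velocity (𝓡 4) γ 0) := by
        rintro x rfl
        exact hγ.isFutureDirected_velocity
      exact key' _ hx0
    exact key _ hγ'0 _ hγ'v
  · -- normalised against `ν_S p`, because `γ` is normalised against `dχ (ν_S p)`
    have key : ∀ (u : E4) (_ : u = w),
        𝒮.metric.val (𝒮.embed p) (show TangentSpace (𝓡 4) (𝒮.embed p) from u) (𝒮.normal p)
          = -1 := by
      rintro u rfl
      rw [hval, hLw]
      exact hγ.val_velocity_normal
    exact key _ hγ'v

/-- **Affine reparametrisations of maximal geodesics are maximal**: `t ↦ γ (a t + b)` on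
`(a · + b)⁻¹' s` for `a ≠ 0` (translate, `IsMaximalGeodesicOn.comp_add`, then rescale,
`IsMaximalGeodesicOn.comp_mul`). O'Neill 1983, Ch. 3, p. 68 with Lemma 3.21.
[cite: ONeill1983, Ch. 3, p. 68] -/
theorem isMaximalGeodesicOn_comp_affine {E : Type*} [NormedAddCommGroup E] [NormedSpace ℝ E]
    {H : Type*} [TopologicalSpace H] {I : ModelWithCorners ℝ E H} {M : Type*}
    [TopologicalSpace M] [ChartedSpace H M] [IsManifold I ∞ M] [FiniteDimensional ℝ E]
    {cov : CovariantDerivative I E (TangentSpace I : M → Type _)} {γ : ℝ → M} {s : Set ℝ}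
    (hγ : IsMaximalGeodesicOn cov γ s) {a : ℝ} (ha : a ≠ 0) (b : ℝ) :
    IsMaximalGeodesicOn cov (fun t ↦ γ (a * t + b)) ((fun t ↦ a * t + b) ⁻¹' s) := by
  have h1 := hγ.comp_add b
  have h2 := h1.comp_mul ha
  have hf : (fun t ↦ γ (a * t + b)) = fun t ↦ (fun u ↦ γ (u - (-b))) (a * t) := by
    funext t
    simp only [sub_neg_eq_add]
  rw [hf]
  exact h2

end Leaf

/-! ## Registered sub-goal -/

section Registered

/-- **Registered sub-goal `stub_softShieldedScri_embedPreimageCompact` of stub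
`stub_softShieldedScri`** (line `Sketch`, crux stmt-FinalStateConjecture-14986): `ι⁻¹(J⁺(K))` is
compact for compact `K` in a Cauchy development — `isCompact_preimage_embed_causalFuture` in the
registered binder form (the compactness of the reference set `B₀ := ι⁻¹ J⁺(leaf core)` of the
transfer). [cite: HawkingEllis1973CUP, §6.6, Prop. 6.6.6 (p. 211)] -/
theorem stub_softShieldedScri_embedPreimageCompact : ∀ (X : Type) [TopologicalSpace X] [ChartedSpace E3 X] [IsManifold (𝓡 3) ∞ X] [ConnectedSpace X] (D : InitialDataSet (𝓡 3) X) (𝓜 : CauchyDevelopment D) (K : Set 𝓜.carrier), IsCompact K → IsCompact (𝓜.embed ⁻¹' 𝓜.metric.causalFuture 𝓜.timeOrientation K) :=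
  fun _ _ _ _ _ _ 𝓜 _ hK ↦ 𝓜.isCompact_preimage_embed_causalFuture hK

end Registered

end SoftShieldedScri

end Summit.FinalStateConjecture.FinalStateConjecture.Theorems.CaptureSufficesC2.Sketch

end
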